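import Summits.BirchSwinnertonDyer.Rank1Residual.X10.ResidualSelmerLocalRamification
import Literature.NumberTheory.DiophantineGeometry.MinimalModelUniquenessProofs
import HarnessLib

/-!
# The `E[p]` instance of the N2 parity law, PART XI: local ramification READ ON THE INTEGER MODEL
# of a globally minimal equation over `ℚ` — `κ_v(P) ∈ H¹_ur ↔ P ∈ E₀(ℤ_v-model)` at a split `I_p` place
# (cell `b2b-bsdres`, unit `b2b-bsdres-x10` = N2 class lead, GEN 32; TOOL — theorems only, no
# definition, no named fact, nothing booked; step (a) of the G-LOCAL chain of X10-AUDIT §38.5d)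

HONEST FRAMING (run/shared/lean/b2b/bsd-rank1-residual/, verbatim in every file): the goal of the
cell is to DELETE the COMBINATION-SHAPED residual classes of the Birch–Swinnerton-Dyer formula for
ALL analytic-rank `≤ 1` elliptic curves over `ℚ` — "full BSD formula for every rank `≤ 1` curve in
class `C`" assembled STRICTLY from published theorems — so that the rank-`≤ 1` remainder becomes
exactly the CONSTRUCTION-SHAPED classes, which are TYPED (missing-input `Prop`s), NOT attempted.
This is not "finishing BSD". Class X10b (= N2) keeps its label CONSTRUCTION-SHAPED (NEEDS `X_A3`,
referee R82.3 / RESIDUAL-MAP §I N2); this file is a TOOL; no mark / label / tier / count moves.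

## What

PART X (`X10/ResidualSelmerLocalRamification.localKummerMap_mem_unramifiedSubgroup_iff_hasNonsingularReduction`)
reads `E₀` on the (chosen) local minimal integral model. For a curve over `ℚ` given by a GLOBALLY
MINIMAL equation `W` with integer model `E₀ = integralModelInt W` (the record currency of the cell),
`E ⊗ ℚ_v` is itself `v`-minimal with integral model `E₀ ⊗ ℤ_v`, so by Silverman VII.1.3(b) (the
tree's `MinimalModelUniquenessProofs.exists_variableChange_integralModel_eq`) the local minimal
integral model is `D' • (E₀ ⊗ ℤ_v)` for a change of variables `D'` over `ℤ_v`, and `E₀(ℚ_v)` is the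
same for both (`LocalIndex.hasNonsingularReduction_pointEquiv_iff`). Result:
**`localKummerMap_mem_unramifiedSubgroup_iff_hasNonsingularReduction_int`** — at a split
multiplicative `v ∤ p` with `ordMinimalDiscriminant v = p`: `κ_v(P) ∈ H¹_ur(ℚ_v, E[p])` iff `P` has
nonsingular reduction on `E₀ ⊗ ℤ_v`, i.e. iff the coordinates of `P` (when `v`-integral) do not
reduce to the node of `E₀ mod v` — the shape the (G) record of `118810j1` needs (step (b), the
decidable coordinate reading, and (c), global → local, follow).

References: [SilvermanAEC2009] VII.1 Prop. 1.3(b), VII.2 Prop. 2.1; [MazurRubin2007] proof of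
Thm. 1.4; HOME/class-closure/N2/G-LOCAL-ASK-x10g32.md ADDENDUM; HOME/X10-AUDIT.md §38.5d.
-/

set_option autoImplicit false

noncomputable section

open scoped Classical NNReal

open Function NumberField IsDedekindDomain Field WeierstrassCurve IsLocalRing
  Literature.NumberTheory.EllipticCurves Literature.NumberTheory.GaloisRepresentations
  IsDedekindDomain.HeightOneSpectrum
open Summit.BirchSwinnertonDyer.Rank1Residual.Additive
open Summit.BirchSwinnertonDyer.Rank1Residual.X10.ResidualSelmerLocalRamification

namespace Summit.BirchSwinnertonDyer.Rank1Residual.X10.ResidualSelmerLocalRamificationInt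

/-! ### §3. Over `ℚ` with a globally minimal equation: `E₀` read on the INTEGER model -/

/-- Transport of `HasNonsingularReduction` along an equality of integral models (cast of the point
along the induced equality of the generic fibres). [folklore] -/
theorem hasNonsingularReduction_congr {R : Type*} [CommRing R] [IsLocalRing R] {L : Type*} [Field L]
    [Algebra R L] {J₁ J₂ : WeierstrassCurve R} (h : J₁ = J₂)
    (π : (J₁.map (algebraMap R L)).toAffine.Point) :
    J₂.HasNonsingularReduction
        (Affine.Point.congrEquiv (congrArg (fun J : WeierstrassCurve R ↦ J.map (algebraMap R L)) h) π) ↔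
      J₁.HasNonsingularReduction π := by
  subst h
  rcases π with _ | ⟨x, y, hπ⟩
  · exact Iff.rfl
  · rw [Affine.Point.congrEquiv_some]

/-- **`κ_v(P)` unramified iff `P ∈ E₀` READ ON THE INTEGER MODEL**, for `W / ℚ` globally minimal with
an integer model `E₀` (`E₀ ⊗ ℤ_v ⊗ ℚ_v = W ⊗ ℚ_v`, e.g. `integralModelInt W`): at a split multiplicative `v ∤ p` with
`ordMinimalDiscriminant v = p`, `κ_v(P) ∈ H¹_ur ↔ (E₀ ⊗ ℤ_v).HasNonsingularReduction P`. The local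
minimal integral model is `D' • (E₀ ⊗ ℤ_v)` for a change of variables `D'` OVER `ℤ_v` (Silverman
VII.1.3(b), the tree's `exists_variableChange_integralModel_eq`: both `E ⊗ ℚ_v` and the local minimal
model are `v`-minimal), and `E₀(ℚ_v)` is the same on both (`LocalIndex.hasNonsingularReduction_pointEquiv_iff`).
[cite: SilvermanAEC2009, VII.1 Prop. 1.3(b) and VII.2 Prop. 2.1] [cite: MazurRubin2007, proof of Thm. 1.4] -/
theorem localKummerMap_mem_unramifiedSubgroup_iff_hasNonsingularReduction_int
    (W : WeierstrassCurve ℚ) [W.IsElliptic] [hGM : W.IsGloballyMinimal] {E₀ : WeierstrassCurve ℤ}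
    (v : HeightOneSpectrum (𝓞 ℚ)) {p : ℕ} [hp : Fact p.Prime]
    (hpv : (p : 𝓞 ℚ) ∉ v.asIdeal) (hsplit : W.HasSplitMultiplicativeReductionAt v)
    (hn : W.ordMinimalDiscriminant v = p) (hp0 : ((p : ℕ) : ℤ) ≠ 0)
    (hX : (E₀.map (Int.castRingHom (v.adicCompletionIntegers ℚ))).baseChange (v.adicCompletion ℚ) =
      W.baseChange (v.adicCompletion ℚ))
    (P : (W.baseChange (v.adicCompletion ℚ)).toAffine.Point) :
    W.localKummerMap (v.adicCompletion ℚ) hp0 P ∈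
        DiscreteGaloisModule.unramifiedSubgroup
          ((W.torsionGaloisModule (p : ℤ)).restrictField (v.adicCompletion ℚ)) 1 ↔
      (E₀.map (Int.castRingHom (v.adicCompletionIntegers ℚ))).HasNonsingularReduction
        (Affine.Point.congrEquiv hX.symm P) := by
  obtain ⟨C₀, hC₀⟩ := W.exists_variableChange_smul_eq_localMinimalModel v
  rw [localKummerMap_mem_unramifiedSubgroup_iff_hasNonsingularReduction W v hpv hsplit hn hC₀ hp0 P]
  -- both `E ⊗ ℚ_v` and the local minimal model are `v`-minimal; `E ⊗ ℚ_v` has integral model `E₀ ⊗ ℤ_v`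
  haveI hminX : (W.baseChange (v.adicCompletion ℚ)).IsMinimal (v.adicCompletionIntegers ℚ) :=
    hGM.isMinimal v
  have hIX : integralModel (v.adicCompletionIntegers ℚ) (W.baseChange (v.adicCompletion ℚ)) =
      E₀.map (Int.castRingHom (v.adicCompletionIntegers ℚ)) := integralModel_eq_of_baseChange_eq _ _ hX
  have hΔ : (W.baseChange (v.adicCompletion ℚ)).Δ ≠ 0 := by
    rw [baseChange, map_Δ]
    exact (_root_.map_ne_zero _).mpr W.isUnit_Δ.ne_zero
  obtain ⟨D', hD'C, hD'I⟩ :=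
    exists_variableChange_integralModel_eq (v.adicCompletionIntegers ℚ)
      (W₁ := W.baseChange (v.adicCompletion ℚ)) (W₂ := W.localMinimalModel v) (D := C₀) hC₀.symm hΔ
  have hJ : W.localMinimalIntegralModel v = D' • E₀.map (Int.castRingHom (v.adicCompletionIntegers ℚ)) := by
    rw [show W.localMinimalIntegralModel v =
      integralModel (v.adicCompletionIntegers ℚ) (W.localMinimalModel v) from rfl, hD'I, hIX]
  rw [← LocalIndex.hasNonsingularReduction_pointEquiv_iff (E₀.map (Int.castRingHom (v.adicCompletionIntegers ℚ)))
      D' (Affine.Point.congrEquiv hX.symm P), ← hasNonsingularReduction_congr hJ]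
  -- the two points of `(D' • I)_{ℚ_v}` agree (`D'_{ℚ_v} = C₀`)
  refine Iff.of_eq (congrArg _ ?_)
  rcases P with _ | ⟨x, y, h⟩
  · change Affine.Point.congrEquiv _ (Affine.Point.congrEquiv _
        (VariableChange.pointEquiv (W.baseChange (v.adicCompletion ℚ)) C₀ 0)) =
      Affine.Point.congrEquiv _ (VariableChange.pointEquiv _ _ (Affine.Point.congrEquiv hX.symm 0))
    simp only [map_zero]
  · rw [VariableChange.pointEquiv_some, Affine.Point.congrEquiv_some, Affine.Point.congrEquiv_some,
      Affine.Point.congrEquiv_some, VariableChange.pointEquiv_some, Affine.Point.congrEquiv_some]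
    exact point_some_congr (by rw [hD'C]) (by rw [hD'C])

end Summit.BirchSwinnertonDyer.Rank1Residual.X10.ResidualSelmerLocalRamificationInt

end
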